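/-
Copyright: the b2b-balaban cell (near-miss cell 7), T⁴-continuum fan-out, lineage t4-ne7b-p3 (node U5c LARGE-DEVIATION
member P3).  Released under the licence of the surrounding project.
-/
import Summits.QuantumFields.BalabanUV.T4Continuum.Support.SpaceTimeCells

/-!
# Space-time Peierls ∕ Cramér route for NE7b — leaf A2a WITH VARIABLE BLOCKING: the space-time cell graph whose step-`u`
# cells are the torus cells of LEVEL `ℓ u` (the run's own cube sides), degree `≤ 3^d + L^{2d} + 1`

Summits-side support leaf of the T⁴-continuum cell (rung (B)+1 on a FINITE torus only; NOT infinite volume, NOT the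
mass gap, NOT the Clay statement; NOT a proof of the spine estimate NE7b).  Lineage `t4-ne7b-p3` (generation 2), node
U5c, skeleton `t4/skeletons/NE7b-t4-ne7b-p3.md` leaf A2a.  [folklore] finite combinatorics on the cell model of
`Support/ZoneTorus.lean` (lineage t4-ne7b-p1: `TCell`, `IsScale`, `cellsAt`, `nearT`, `card_nearT_le`) and A1 of
`SpaceTimeAnimals` ∕ `SpaceTimeCells` (this lineage), imported BY NAME; nothing printed is asserted; no `[cite:]` tag.

WHY.  `SpaceTimeCells` (A2a, p207880) blocks by `L` at EVERY step (uniform model; the located item «size-ratio excess of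
non-uniform blockings»).  Bałaban's step-`u` cubes have side `M R_u L^{−u}` with `R_u = L^{s_u}` ((2.5)), so the ratio
of consecutive sides is `L^{e_u}`, `e_u ∈ {0, 1, 2}`; in the fine torus of the cutoff the step-`u` cells are the cells
of LEVEL `ℓ u` for a non-decreasing level map with increments `≤ 2` (the COUNT swarm's `HistoryZones.levelOf`, the
index model's `B16SProfile.ratio`).  This file removes the uniform simplification: the space-time cells are the pairs
(step `u ≤ K`, torus cell of level `ℓ u`) and the vertical relation links a step-`u` cell to the step-`(u+1)` cell whose
level-`ℓ(u+1)` block contains it.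
* §1 `STCellV d n L Kx K ℓ`, `stRelV`, `stGraphV`.
* §2 **`degree_stGraphV_le`**: degree `≤ 3^d + L^{2d} + 1` when the level map has increments `≤ 2` (lateral
  `≤ 3^d`, parent `≤ 1`, children `≤ (L^d)^{ℓ u − ℓ(u−1)} ≤ L^{2d}`).
* §3 `card_anchorsV_le`: the step-`K` cells number `≤ (n·L^{Kx − ℓ K})^d`.
* §4 `card_animals_stGraphV_le` (A1 applied): connected cell sets of size `m` through a cell `≤ ((3^d + L^{2d} + 2)²)^m`
  — the entropy fields `deg`∕`animal`∕`anchors` of `SpaceTimeAssembly.LineageReadings` on the variable-level complex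
  with `Δ = 3^d + L^{2d} + 1`, `Δ₁ = (Δ+1)²`, `Nanc = (n·L^{Kx − ℓ K})^d`.

HONEST DEPENDENCY (cell, verbatim): continuum YM on T⁴ ⇐ BetaPertH ∧ nine spine estimates (0/9 proved); BetaPertH ⇐
(D1) ∧ (D4) ∧ CAP+tail; G-an2-4 gates asym, D1 and NE2/3/4.  This file changes none of it.
-/

open Finset

namespace Summit.QuantumFields.BalabanUV.T4Continuum.SpaceTimePeierls

open Summit.QuantumFields.BalabanUV.T4Continuum.ZoneTorus SpaceTimePeierlsLeaves

open scoped Classical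

noncomputable section

/-! ## §1 Space-time cells with a level map -/

/-- SPACE-TIME CELLS WITH VARIABLE BLOCKING: a step `u ≤ K` and a cell of level `ℓ u` of the fine torus
`(ℤ∕nL^{Kx})^d` (`Kx` = the top level). [folklore] -/
abbrev STCellV (d n L Kx K : ℕ) (ℓ : ℕ → ℕ) := {p : Fin (K + 1) × TCell d (n * L ^ Kx) // IsScale L (ℓ p.1.val) p.2}

variable {d n L Kx K : ℕ} {ℓ : ℕ → ℕ}

/-- the step of a space-time cell [folklore] -/
abbrev STCellV.sc (v : STCellV d n L Kx K ℓ) : ℕ := v.1.1.val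

/-- the underlying torus cell [folklore] -/
abbrev STCellV.pt (v : STCellV d n L Kx K ℓ) : TCell d (n * L ^ Kx) := v.1.2

variable (d n L Kx K ℓ) in
/-- the generating relation: LATERAL (same step, level-`ℓ u` blocks at cyclic sup-distance `≤ 1`) or VERTICAL (`w` is at
the next step and its level-`ℓ(u+1)` block contains `v`). [folklore] -/
def stRelV (v w : STCellV d n L Kx K ℓ) : Prop :=
  (v.sc = w.sc ∧ nearT n L Kx v.pt (ℓ v.sc) w.pt (ℓ w.sc) (ℓ v.sc) 1) ∨
    (v.sc + 1 = w.sc ∧ nearT n L Kx v.pt (ℓ v.sc) w.pt (ℓ w.sc) (ℓ w.sc) 0)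

variable (d n L Kx K ℓ) in
/-- THE SPACE-TIME CELL GRAPH with variable blocking. [folklore] -/
def stGraphV : SimpleGraph (STCellV d n L Kx K ℓ) := SimpleGraph.fromRel (stRelV d n L Kx K ℓ)

/-! ## §2 The degree bound -/

/-- two cells with the same step and torus cell are equal [folklore] -/
theorem STCellV.ext_of {v w : STCellV d n L Kx K ℓ} (hs : v.sc = w.sc) (hp : v.pt = w.pt) : v = w := by
  apply Subtype.ext
  apply Prod.ext
  · exact Fin.ext hs
  · exact hp

/-- the cells of a given step `s` whose torus cell satisfies `P` inject into the torus cells satisfying `P` [folklore] -/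
theorem card_filter_stepV_le (s : ℕ) (P : TCell d (n * L ^ Kx) → Prop) :
    ((univ : Finset (STCellV d n L Kx K ℓ)).filter fun w => w.sc = s ∧ P w.pt).card
      ≤ ((univ : Finset (TCell d (n * L ^ Kx))).filter P).card := by
  refine card_le_card_of_injOn (fun w => w.pt) (fun w hw => ?_) (fun w₁ hw₁ w₂ hw₂ h => ?_)
  · have := (mem_filter.1 (mem_coe.1 hw)).2
    exact mem_coe.2 (mem_filter.2 ⟨mem_univ _, this.2⟩)
  · have h1 := (mem_filter.1 (mem_coe.1 hw₁)).2.1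
    have h2 := (mem_filter.1 (mem_coe.1 hw₂)).2.1
    exact STCellV.ext_of (h1.trans h2.symm) h

/-- **THE DEGREE BOUND WITH VARIABLE BLOCKING**: for a level map with increments at most `2`, every
space-time cell has at most `3^d` lateral neighbours, at most one parent and at most `L^{2d}` children:
`degree ≤ 3^d + L^{2d} + 1` (`L ≥ 1`; only the bound on the increments is used). [folklore] -/
theorem degree_stGraphV_le (hL : 1 ≤ L) (hjump : ∀ u, ℓ (u + 1) ≤ ℓ u + 2)
    (v : STCellV d n L Kx K ℓ) : (stGraphV d n L Kx K ℓ).degree v ≤ 3 ^ d + L ^ (2 * d) + 1 := by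
  rw [← SimpleGraph.card_neighborFinset_eq_degree, SimpleGraph.neighborFinset_eq_filter]
  set Lat := (univ : Finset (STCellV d n L Kx K ℓ)).filter fun w =>
      w.sc = v.sc ∧ nearT n L Kx v.pt (ℓ v.sc) w.pt (ℓ v.sc) (ℓ v.sc) 1 with hLat
  set Up := (univ : Finset (STCellV d n L Kx K ℓ)).filter fun w =>
      w.sc = v.sc + 1 ∧ nearT n L Kx v.pt (ℓ v.sc) w.pt (ℓ (v.sc + 1)) (ℓ (v.sc + 1)) 0 with hUp
  set Dn := (univ : Finset (STCellV d n L Kx K ℓ)).filter fun w =>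
      w.sc = v.sc - 1 ∧ nearT n L Kx w.pt (ℓ (v.sc - 1)) v.pt (ℓ v.sc) (ℓ v.sc) 0 with hDn
  have hsub : ((univ : Finset (STCellV d n L Kx K ℓ)).filter fun w => (stGraphV d n L Kx K ℓ).Adj v w)
      ⊆ Lat ∪ (Up ∪ Dn) := by
    intro w hw
    have hadj := (mem_filter.1 hw).2
    rw [stGraphV, SimpleGraph.fromRel_adj] at hadj
    obtain ⟨_, h | h⟩ := hadj
    · rcases h with ⟨hs, hn⟩ | ⟨hs, hn⟩
      · refine mem_union_left _ (mem_filter.2 ⟨mem_univ _, hs.symm, ?_⟩)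
        rw [← hs] at hn; exact hn
      · refine mem_union_right _ (mem_union_left _ (mem_filter.2 ⟨mem_univ _, hs.symm, ?_⟩))
        rw [hs]; exact hn
    · rcases h with ⟨hs, hn⟩ | ⟨hs, hn⟩
      · refine mem_union_left _ (mem_filter.2 ⟨mem_univ _, hs, ?_⟩)
        have h' := (nearT_comm n L Kx w.pt (ℓ w.sc) v.pt (ℓ v.sc) (ℓ w.sc) 1).1 hn
        rw [hs] at h'; exact h'
      · refine mem_union_right _ (mem_union_right _ (mem_filter.2 ⟨mem_univ _, by omega, ?_⟩))
        have h1 : v.sc - 1 = w.sc := by omega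
        rw [h1]; exact hn
  have hLat' : Lat.card ≤ 3 ^ d := by
    refine (card_filter_stepV_le v.sc _).trans ((card_nearT_le n hL Kx v.pt (ℓ v.sc) (ℓ v.sc) (ℓ v.sc) 1).trans ?_)
    simp [NZT]
  have hUp' : Up.card ≤ 1 := by
    refine (card_filter_stepV_le (v.sc + 1) _).trans
      ((card_nearT_le n hL Kx v.pt (ℓ v.sc) (ℓ (v.sc + 1)) (ℓ (v.sc + 1)) 0).trans ?_)
    simp [NZT]
  have hDn' : Dn.card ≤ L ^ (2 * d) := by
    refine (card_filter_stepV_le (v.sc - 1) _).trans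
      ((card_nearT_le' n hL Kx v.pt (ℓ (v.sc - 1)) (ℓ v.sc) (ℓ v.sc) 0).trans ?_)
    simp only [NZT, Nat.floor_zero, mul_zero, zero_add, one_pow, one_mul]
    have hinc : ℓ v.sc - ℓ (v.sc - 1) ≤ 2 := by
      rcases Nat.eq_zero_or_pos v.sc with h0 | hpos
      · rw [h0]; simp
      · have := hjump (v.sc - 1)
        rw [show v.sc - 1 + 1 = v.sc by omega] at this
        omega
    calc (L ^ d) ^ (ℓ v.sc - ℓ (v.sc - 1)) ≤ (L ^ d) ^ 2 := pow_le_pow_right₀ (Nat.one_le_pow _ _ hL) hinc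
      _ = L ^ (2 * d) := by rw [← pow_mul, mul_comm]
  calc ((univ : Finset (STCellV d n L Kx K ℓ)).filter fun w => (stGraphV d n L Kx K ℓ).Adj v w).card
      ≤ (Lat ∪ (Up ∪ Dn)).card := card_le_card hsub
    _ ≤ Lat.card + (Up.card + Dn.card) := (card_union_le _ _).trans (Nat.add_le_add_left (card_union_le _ _) _)
    _ ≤ 3 ^ d + (1 + L ^ (2 * d)) := Nat.add_le_add hLat' (Nat.add_le_add hUp' hDn')
    _ = 3 ^ d + L ^ (2 * d) + 1 := by ring

/-! ## §3 Anchors: the cells of the final step -/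

/-- the space-time cells of the final step `K` number at most `(n·L^{Kx − ℓ K})^d` (`ℓ K ≤ Kx`). [folklore] -/
theorem card_anchorsV_le (hL : 1 ≤ L) (hK : ℓ K ≤ Kx) :
    ((univ : Finset (STCellV d n L Kx K ℓ)).filter fun w => w.sc = K).card ≤ (n * L ^ (Kx - ℓ K)) ^ d := by
  have h := card_filter_stepV_le (d := d) (n := n) (L := L) (Kx := Kx) (K := K) (ℓ := ℓ) K (IsScale L (ℓ K))
  have hset : ((univ : Finset (STCellV d n L Kx K ℓ)).filter fun w => w.sc = K)
      = (univ : Finset (STCellV d n L Kx K ℓ)).filter fun w => w.sc = K ∧ IsScale L (ℓ K) w.pt := by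
    refine filter_congr fun w _ => ⟨fun hw => ⟨hw, ?_⟩, fun hw => hw.1⟩
    have := w.2
    rw [show w.1.1.val = K from hw] at this
    exact this
  rw [hset]
  refine h.trans ?_
  have hc := card_cellsAt (d := d) n hL hK
  rw [cellsAt] at hc
  exact hc.le

/-! ## §4 Animals, and the entropy fields of the lineage readings -/

/-- **ANIMALS ON THE VARIABLE-LEVEL SPACE-TIME CELL GRAPH** (A1 applied): the connected cell sets of size `m` through
a given cell number at most `((3^d + L^{2d} + 2)²)^m`. [folklore] -/
theorem card_animals_stGraphV_le (hL : 1 ≤ L) (hjump : ∀ u, ℓ (u + 1) ≤ ℓ u + 2)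
    (v : STCellV d n L Kx K ℓ) (m : ℕ) :
    (Nat.card {S : Finset (STCellV d n L Kx K ℓ) //
        v ∈ S ∧ S.card = m ∧ ((stGraphV d n L Kx K ℓ).induce (S : Set (STCellV d n L Kx K ℓ))).Connected} : ℝ)
      ≤ ((((3 ^ d + L ^ (2 * d) + 1 : ℕ) : ℝ) + 1) ^ 2) ^ m :=
  siteAnimalBound_sq (3 ^ d + L ^ (2 * d) + 1) (STCellV d n L Kx K ℓ) (stGraphV d n L Kx K ℓ)
    (degree_stGraphV_le hL hjump) v m

end

end Summit.QuantumFields.BalabanUV.T4Continuum.SpaceTimePeierls
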